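import Summits.RiemannHypothesis.RiemannHypothesis.Theorems.UniversalFactorLehmerTails

/-!
# RiemannHypothesis / UniversalFactor — tail bounds for the one-sided Laplace(`a`) averages of `H_0`

Route `RiemannHypothesis/UniversalFactor`, item `MediumKernelNoGo` (stmt-RiemannHypothesis-2577),
line `one-sided-average-sign-test`, stubs `stub_highTailQ` and `stub_highTailP`.

The certificate for the one-point sign test computes the one-sided averages
`∫₀^∞ H_0(2t₀ ± y) e^{−ay} dy` by certified quadrature on `y ≤ Y`; this file bounds the remainders
`∫_{y > Y}` for a GENERAL rate `a ≥ 1`, generalising `UniversalFactor.lehmer_tail_Q` and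
`UniversalFactor.lehmer_tail_P` (the case `a = 16`) of `UniversalFactorLehmerTails`:

* `UniversalFactor.stub_highTailQ` — for `t₀ ≥ 4`, `Y ≥ 0`:
  `∫_{y>Y} ‖H_0(2t₀ + y) e^{−ay}‖ dy ≤ K₀ · C(t₀) (t₀+1)³ e^{−aY}/a`;
* `UniversalFactor.highFar_le_lehmerK0` — `e^{−a(2t₀−4)}/(4a) ≤ K₀(t₀)` for `t₀ ≥ 7000`, `a ≥ 1`;
* `UniversalFactor.stub_highTailP` — for `t₀ ≥ 7000`, `0 ≤ Y ≤ 2t₀ − 4`: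
  `∫_{y>Y} ‖H_0(2t₀ − y) e^{−ay}‖ dy ≤ K₀ · (C(t₀)(t₀+1)³ e^{−(a−π/8)Y}/(a−π/8) + 1)`.

Here `K₀ = UniversalFactor.lehmerK0 t₀`, `C(t₀) = UniversalFactor.lehmerTailConst t₀`, and the
pointwise input is `UniversalFactor.norm_deBruijnH_zero_two_mul_le`
(`‖H_0(2t)‖ ≤ K₀ · C(t₀) · (t+1)³ · e^{(π/4)(t₀ − t)}` for `t, t₀ ≥ 2`) together with the crude
global bound `‖H_0(x)‖ ≤ ¼` (`UniversalFactor.norm_deBruijnH_zero_le_quarter`) on the far part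
`y > 2t₀ − 4` of the backward tail.

References: E. C. Titchmarsh, *The Theory of the Riemann Zeta-Function* (1986), §2.1, §2.12, §4.12.
-/

noncomputable section

set_option linter.dupNamespace false

namespace Summit.RiemannHypothesis.RiemannHypothesis.Theorems

open Set MeasureTheory Literature.NumberTheory.LFunctions

/-- **Tail of the forward average, general rate.** For `t₀ ≥ 4`, `a ≥ 1` and `Y ≥ 0`:
`∫_{y>Y} ‖H_0(2t₀ + y) e^{−ay}‖ dy ≤ K₀ · C(t₀) (t₀+1)³ e^{−aY}/a`. [folklore] -/
theorem UniversalFactor.stub_highTailQ :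
    ∀ (t₀ a Y : ℝ), 4 ≤ t₀ → 1 ≤ a → 0 ≤ Y →
      ∫ y in Set.Ioi Y, ‖deBruijnH 0 (((2 * t₀ : ℝ) : ℂ) + (y : ℂ)) * (Real.exp (-(a * y)) : ℂ)‖ ≤
        UniversalFactor.lehmerK0 t₀ *
          (UniversalFactor.lehmerTailConst t₀ * (t₀ + 1) ^ 3 * Real.exp (-(a * Y)) / a) := by
  intro t₀ a Y ht₀ ha hY
  have ha0 : 0 < a := by linarith
  set A : ℝ := UniversalFactor.lehmerK0 t₀ * UniversalFactor.lehmerTailConst t₀ * (t₀ + 1) ^ 3 with hA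
  have hK := UniversalFactor.lehmerK0_pos t₀
  have hC : 0 < UniversalFactor.lehmerTailConst t₀ := by
    unfold UniversalFactor.lehmerTailConst; positivity
  have hA0 : 0 ≤ A := by positivity
  -- pointwise bound
  have hpt : ∀ y ∈ Ioi Y, ‖deBruijnH 0 (((2 * t₀ : ℝ) : ℂ) + (y : ℂ)) * (Real.exp (-(a * y)) : ℂ)‖ ≤
      A * Real.exp (-a * y) := by
    intro y hy
    have hy0 : 0 ≤ y := hY.trans (le_of_lt hy)
    rw [norm_mul, Complex.norm_real, Real.norm_of_nonneg (Real.exp_pos _).le,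
      show (((2 * t₀ : ℝ) : ℂ) + (y : ℂ)) = ((2 * (t₀ + y / 2) : ℝ) : ℂ) by push_cast; ring]
    have h := UniversalFactor.norm_deBruijnH_zero_two_mul_le (t₀ := t₀) (t := t₀ + y / 2)
      (by linarith) (by linarith)
    have hcube := UniversalFactor.cube_mul_exp_le ht₀ hy0
    have e1 : Real.exp (Real.pi / 4 * (t₀ - (t₀ + y / 2))) = Real.exp (-(Real.pi / 8 * y)) := by
      congr 1; ring
    rw [e1] at h
    have e2 : Real.exp (-(a * y)) = Real.exp (-a * y) := by congr 1; ring
    rw [e2]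
    calc ‖deBruijnH 0 ((2 * (t₀ + y / 2) : ℝ) : ℂ)‖ * Real.exp (-a * y)
        ≤ UniversalFactor.lehmerK0 t₀ * UniversalFactor.lehmerTailConst t₀ * (t₀ + y / 2 + 1) ^ 3 *
            Real.exp (-(Real.pi / 8 * y)) * Real.exp (-a * y) :=
          mul_le_mul_of_nonneg_right h (Real.exp_pos _).le
      _ = UniversalFactor.lehmerK0 t₀ * UniversalFactor.lehmerTailConst t₀ *
            ((t₀ + y / 2 + 1) ^ 3 * Real.exp (-(Real.pi / 8 * y))) * Real.exp (-a * y) := by ring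
      _ ≤ UniversalFactor.lehmerK0 t₀ * UniversalFactor.lehmerTailConst t₀ * (t₀ + 1) ^ 3 *
            Real.exp (-a * y) := by gcongr
  -- integrate the majorant
  have hg : IntegrableOn (fun y : ℝ => A * Real.exp (-a * y)) (Ioi Y) :=
    (integrableOn_exp_mul_Ioi (by linarith) Y).const_mul A
  have hmono := integral_mono_of_nonneg (μ := volume.restrict (Ioi Y))
    (Filter.Eventually.of_forall fun y => norm_nonneg
      (deBruijnH 0 (((2 * t₀ : ℝ) : ℂ) + (y : ℂ)) * (Real.exp (-(a * y)) : ℂ)))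
    hg ((ae_restrict_iff' measurableSet_Ioi).2 (Filter.Eventually.of_forall hpt))
  refine hmono.trans (le_of_eq ?_)
  rw [integral_const_mul, integral_exp_mul_Ioi (by linarith) Y, hA, neg_div_neg_eq,
    show -a * Y = -(a * Y) by ring]
  ring

/-- `e^{−a(2t₀−4)}/(4a) ≤ K₀(t₀)` for `t₀ ≥ 7000` and `a ≥ 1` (the far tail of the backward
average, where only `|H_0| ≤ ¼` is used, is negligible even against the astronomically small
`K₀`). [folklore] -/
theorem UniversalFactor.highFar_le_lehmerK0 {t₀ a : ℝ} (ht₀ : 7000 ≤ t₀) (ha : 1 ≤ a) :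
    1 / 4 * (Real.exp (-a * (2 * t₀ - 4)) / a) ≤ UniversalFactor.lehmerK0 t₀ := by
  refine le_trans ?_ (UniversalFactor.lehmerK0_ge (by linarith))
  have hlogπ : Real.log Real.pi ≤ 2 := by
    rw [Real.log_le_iff_le_exp Real.pi_pos]
    have h1 : (2.7 : ℝ) < Real.exp 1 := lt_trans (by norm_num) Real.exp_one_gt_d9
    have h2 : Real.exp 2 = Real.exp 1 * Real.exp 1 := by rw [← Real.exp_add]; norm_num
    nlinarith [Real.pi_lt_four, Real.exp_pos 1]
  have hlogt : Real.log (t₀ / 2) ≤ t₀ / 2 :=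
    (Real.log_le_sub_one_of_pos (by linarith)).trans (by linarith)
  have hlog2π : 0 ≤ Real.log (2 * Real.pi) := Real.log_nonneg (by linarith [Real.pi_gt_three])
  have hπt : Real.pi * t₀ ≤ 4 * t₀ := by nlinarith [Real.pi_lt_four]
  have key : -(2 * t₀ - 4) + 3 ≤ -Real.log Real.pi / 4 + (-Real.log (t₀ / 2) / 4 -
      Real.pi * t₀ / 4 + Real.log (2 * Real.pi) / 2 - (3 / 128 + Real.pi / 8 + 1 / 2)) := by
    linarith [Real.pi_lt_four]
  have h := Real.exp_le_exp.2 key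
  rw [Real.exp_add] at h
  have he3 : (4 : ℝ) ≤ Real.exp 3 := by
    have := Real.add_one_le_exp (3 : ℝ)
    linarith
  have hE := Real.exp_pos (-(2 * t₀ - 4))
  have ha0 : 0 < a := by linarith
  have hy₁ : 0 ≤ 2 * t₀ - 4 := by linarith
  have hexp_a : Real.exp (-a * (2 * t₀ - 4)) ≤ Real.exp (-(2 * t₀ - 4)) :=
    Real.exp_le_exp.2 (by nlinarith [mul_nonneg (sub_nonneg.2 ha) hy₁])
  have h3 : Real.exp (-a * (2 * t₀ - 4)) / a ≤ Real.exp (-(2 * t₀ - 4)) := by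
    rw [div_le_iff₀ ha0]
    have : Real.exp (-(2 * t₀ - 4)) * 1 ≤ Real.exp (-(2 * t₀ - 4)) * a :=
      mul_le_mul_of_nonneg_left ha hE.le
    linarith
  have h4 : Real.exp (-(2 * t₀ - 4)) * 4 ≤ Real.exp (-(2 * t₀ - 4)) * Real.exp 3 :=
    mul_le_mul_of_nonneg_left he3 hE.le
  linarith

/-- **Tail of the backward average, general rate.** For `t₀ ≥ 7000`, `a ≥ 1` and
`0 ≤ Y ≤ 2t₀ − 4`:
`∫_{y>Y} ‖H_0(2t₀ − y) e^{−ay}‖ dy ≤ K₀ · (C(t₀)(t₀+1)³ e^{−(a−π/8)Y}/(a−π/8) + 1)`. [folklore] -/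
theorem UniversalFactor.stub_highTailP :
    ∀ (t₀ a Y : ℝ), 7000 ≤ t₀ → 1 ≤ a → 0 ≤ Y → Y ≤ 2 * t₀ - 4 →
      ∫ y in Set.Ioi Y, ‖deBruijnH 0 (((2 * t₀ : ℝ) : ℂ) - (y : ℂ)) * (Real.exp (-(a * y)) : ℂ)‖ ≤
        UniversalFactor.lehmerK0 t₀ *
          (UniversalFactor.lehmerTailConst t₀ * (t₀ + 1) ^ 3 * Real.exp (-((a - Real.pi / 8) * Y)) /
            (a - Real.pi / 8) + 1) := by
  intro t₀ a Y ht₀ ha hY hY'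
  have ha0 : 0 < a := by linarith
  have hfar := UniversalFactor.highFar_le_lehmerK0 ht₀ ha
  set A : ℝ := UniversalFactor.lehmerK0 t₀ * UniversalFactor.lehmerTailConst t₀ * (t₀ + 1) ^ 3 with hA
  set y₁ : ℝ := 2 * t₀ - 4 with hy₁
  have hK := UniversalFactor.lehmerK0_pos t₀
  have hC : 0 < UniversalFactor.lehmerTailConst t₀ := by
    unfold UniversalFactor.lehmerTailConst; positivity
  have hA0 : 0 ≤ A := by positivity
  have hrate : (0:ℝ) < a - Real.pi / 8 := by nlinarith [Real.pi_lt_four]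
  -- the majorant
  set g : ℝ → ℝ := fun y => A * Real.exp (-(a - Real.pi / 8) * y) +
    (Ioi y₁).indicator (fun y => (1 / 4 : ℝ) * Real.exp (-a * y)) y with hg_def
  have hpt : ∀ y ∈ Ioi Y,
      ‖deBruijnH 0 (((2 * t₀ : ℝ) : ℂ) - (y : ℂ)) * (Real.exp (-(a * y)) : ℂ)‖ ≤ g y := by
    intro y hy
    have hy0 : 0 ≤ y := hY.trans (le_of_lt hy)
    rw [norm_mul, Complex.norm_real, Real.norm_of_nonneg (Real.exp_pos _).le,
      show (((2 * t₀ : ℝ) : ℂ) - (y : ℂ)) = ((2 * (t₀ - y / 2) : ℝ) : ℂ) by push_cast; ring]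
    have hfirst0 : 0 ≤ A * Real.exp (-(a - Real.pi / 8) * y) := by positivity
    have hind0 : 0 ≤ (Ioi y₁).indicator (fun y => (1 / 4 : ℝ) * Real.exp (-a * y)) y :=
      Set.indicator_nonneg (fun _ _ => by positivity) _
    rcases le_or_gt y y₁ with hle | hgt
    · -- `t = t₀ − y/2 ≥ 2`
      have h := UniversalFactor.norm_deBruijnH_zero_two_mul_le (t₀ := t₀) (t := t₀ - y / 2)
        (by linarith) (by rw [hy₁] at hle; linarith)
      have e1 : Real.exp (Real.pi / 4 * (t₀ - (t₀ - y / 2))) = Real.exp (Real.pi / 8 * y) := by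
        congr 1; ring
      rw [e1] at h
      have hcube : (t₀ - y / 2 + 1) ^ 3 ≤ (t₀ + 1) ^ 3 :=
        pow_le_pow_left₀ (by linarith) (by linarith) 3
      calc ‖deBruijnH 0 ((2 * (t₀ - y / 2) : ℝ) : ℂ)‖ * Real.exp (-(a * y))
          ≤ UniversalFactor.lehmerK0 t₀ * UniversalFactor.lehmerTailConst t₀ * (t₀ - y / 2 + 1) ^ 3 *
              Real.exp (Real.pi / 8 * y) * Real.exp (-(a * y)) :=
            mul_le_mul_of_nonneg_right h (Real.exp_pos _).le
        _ ≤ UniversalFactor.lehmerK0 t₀ * UniversalFactor.lehmerTailConst t₀ * (t₀ + 1) ^ 3 *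
              Real.exp (Real.pi / 8 * y) * Real.exp (-(a * y)) := by gcongr
        _ = A * Real.exp (-(a - Real.pi / 8) * y) := by
            rw [hA, mul_assoc, ← Real.exp_add]; congr 1; congr 1; ring
        _ ≤ g y := by simp only [hg_def]; linarith
    · -- `y > y₁`: the crude bound `‖H_0‖ ≤ 1/4`
      have h := UniversalFactor.norm_deBruijnH_zero_le_quarter (2 * (t₀ - y / 2))
      have hind : (Ioi y₁).indicator (fun y => (1 / 4 : ℝ) * Real.exp (-a * y)) y =
          1 / 4 * Real.exp (-a * y) := Set.indicator_of_mem hgt _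
      calc ‖deBruijnH 0 ((2 * (t₀ - y / 2) : ℝ) : ℂ)‖ * Real.exp (-(a * y))
          ≤ 1 / 4 * Real.exp (-(a * y)) := mul_le_mul_of_nonneg_right h (Real.exp_pos _).le
        _ = 1 / 4 * Real.exp (-a * y) := by congr 1; congr 1; ring
        _ ≤ g y := by simp only [hg_def]; rw [hind]; linarith
  -- integrability and integral of the majorant
  have hg1 : IntegrableOn (fun y : ℝ => A * Real.exp (-(a - Real.pi / 8) * y)) (Ioi Y) :=
    (integrableOn_exp_mul_Ioi (by linarith) Y).const_mul A
  have hg2 : IntegrableOn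
      (fun y : ℝ => (Ioi y₁).indicator (fun y => (1 / 4 : ℝ) * Real.exp (-a * y)) y) (Ioi Y) :=
    (((integrableOn_exp_mul_Ioi (by linarith) Y).const_mul (1 / 4 : ℝ)).indicator measurableSet_Ioi)
  have hgi : IntegrableOn g (Ioi Y) := hg1.add hg2
  have hmono := integral_mono_of_nonneg (μ := volume.restrict (Ioi Y))
    (Filter.Eventually.of_forall fun y => norm_nonneg
      (deBruijnH 0 (((2 * t₀ : ℝ) : ℂ) - (y : ℂ)) * (Real.exp (-(a * y)) : ℂ)))
    hgi ((ae_restrict_iff' measurableSet_Ioi).2 (Filter.Eventually.of_forall hpt))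
  refine hmono.trans ?_
  have hI1 : ∫ y in Ioi Y, A * Real.exp (-(a - Real.pi / 8) * y) =
      A * Real.exp (-((a - Real.pi / 8) * Y)) / (a - Real.pi / 8) := by
    rw [integral_const_mul, integral_exp_mul_Ioi (by linarith) Y]
    have : -(a - Real.pi / 8) * Y = -((a - Real.pi / 8) * Y) := by ring
    rw [this, neg_div_neg_eq]
    ring
  have hI2 : ∫ y in Ioi Y, (Ioi y₁).indicator (fun y => (1 / 4 : ℝ) * Real.exp (-a * y)) y =
      1 / 4 * (Real.exp (-a * y₁) / a) := by
    rw [integral_indicator measurableSet_Ioi, Measure.restrict_restrict measurableSet_Ioi,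
      Ioi_inter_Ioi, sup_eq_left.2 hY', integral_const_mul, integral_exp_mul_Ioi (by linarith) y₁,
      neg_div_neg_eq]
  rw [hg_def, integral_add hg1 hg2, hI1, hI2, hA]
  have e : UniversalFactor.lehmerK0 t₀ * (UniversalFactor.lehmerTailConst t₀ * (t₀ + 1) ^ 3 *
      Real.exp (-((a - Real.pi / 8) * Y)) / (a - Real.pi / 8) + 1) =
      UniversalFactor.lehmerK0 t₀ * UniversalFactor.lehmerTailConst t₀ * (t₀ + 1) ^ 3 *
        Real.exp (-((a - Real.pi / 8) * Y)) / (a - Real.pi / 8) + UniversalFactor.lehmerK0 t₀ := by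
    ring
  rw [e]
  linarith

end Summit.RiemannHypothesis.RiemannHypothesis.Theorems
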